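import Summits.CriticalPhenomena.PercolationContinuityZ3.Theorems.PercNearOneGluingNoHeavyLowerTailSahiLatinSections

/-!
# `NoHeavyLowerTail` (crux stmt-CriticalPhenomena-4575), Sahi programme (prim-master-conj gen 49): GLUING THREE SECTIONS along one axis and
# the FIVE-SET IDENTITY — the Latin kernel of a (cylinder, lower-step, lower-step) triple of `[3]^{Option κ}` in dimension `κ`

Support file (`--supports stmt-CriticalPhenomena-4575`; toolkit, definitions + identities).  Memo
`run/shared/lean/prim/prim-l12/FROM-prim-master-conj-g49-PEELING-THEOREM.md` §1 (and gen-48 memo §8).  Nothing here is specific to percolation;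
nothing is asserted about the crux.

THE MATHEMATICS.  `ofSections s₀ s₁ s₂ ⊆ [3]^{Option κ}` is the set whose sections along the axis `none` are `s₀, s₁, s₂`
(`sec_ofSections_zero/one/two`); it is an up-set when `s₀ ⊆ s₁ ⊆ s₂` are up-sets (`isUpperSet_ofSections`).  A CYLINDER is `ofSections A A A`, a
LOWER-STEP slot is `ofSections B B B'` (sections `B` at levels `0,1` and `B'` at the top level).  THEOREM (`kappa_cyl_lowerStep_lowerStep`, every `κ`,
arbitrary finsets): with `S1`, `latinPairs` (= totally-distinct pair count) of `…SahiLatinFunctionals/Harris`,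
  `κ(cyl A, (B,B,B'), (C,C,C')) = 2κ(A,B,C) + 2κ(A,B,C') + 2κ(A,B',C)`
  `   + 4·[S1(ABC) + S1(AB'C') − S1(ABC') − S1(AB'C)] − 2·[L(A,BC) + L(A,B'C') − L(A,BC') − L(A,B'C)]`
— for nested `B ⊆ B'`, `C ⊆ C'` the bracket terms are `4·S1(A ∩ ΔB ∩ ΔC) − 2·L(A, ΔB ∩ ΔC)` (`ΔB = B' ∖ B`), i.e. the top-section kernel
`κ(A,B',C')` does NOT occur: top-slice dominance `κ_{n+1} ≥ c·κ_n(top sections)` restricted to this family is a FIVE-SET inequality in dimension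
`κ` (the frame in which prim-ineq-gen-4's conjecture (C¼) / the zero-bottom family is analysed in the memo).  Proof: the letter expansion
`kappa_option` of `…SahiLatinSections`, the six letters by `sum_perm3`, the sections of the glued sets, and `kappa_eq_functionals`.
Everything here is proved; axioms standard. [this work]
-/

namespace Summit.CriticalPhenomena.PercolationContinuityZ3.Theorems.SahiLatin

open Finset

variable {κ : Type*} [Fintype κ] [DecidableEq κ]

/-! ## §1  Gluing three sections -/

/-- The subset of `[3]^{Option κ}` with prescribed sections `s₀, s₁, s₂` along the axis `none`. [this work] -/
def ofSections (s₀ s₁ s₂ : Finset (Pt κ)) : Finset (Pt (Option κ)) :=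
  univ.filter fun x => (x none = 0 ∧ (fun k => x (some k)) ∈ s₀) ∨ (x none = 1 ∧ (fun k => x (some k)) ∈ s₁) ∨
    (x none = 2 ∧ (fun k => x (some k)) ∈ s₂)

/-- Membership of a glued point in `ofSections`. [this work] -/
theorem glue_mem_ofSections {s₀ s₁ s₂ : Finset (Pt κ)} {l : Fin 3} {x' : Pt κ} :
    glue l x' ∈ ofSections s₀ s₁ s₂ ↔ (l = 0 ∧ x' ∈ s₀) ∨ (l = 1 ∧ x' ∈ s₁) ∨ (l = 2 ∧ x' ∈ s₂) := by
  simp only [ofSections, mem_filter, mem_univ, true_and, glue_none]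
  have e : (fun k => glue l x' (some k)) = x' := funext fun k => glue_some l x' k
  rw [e]

/-- Section `0` of `ofSections`. [this work] -/
@[simp] theorem sec_ofSections_zero (s₀ s₁ s₂ : Finset (Pt κ)) : sec (ofSections s₀ s₁ s₂) 0 = s₀ := by
  ext x'; rw [mem_sec, glue_mem_ofSections]; simp

/-- Section `1` of `ofSections`. [this work] -/
@[simp] theorem sec_ofSections_one (s₀ s₁ s₂ : Finset (Pt κ)) : sec (ofSections s₀ s₁ s₂) 1 = s₁ := by
  ext x'; rw [mem_sec, glue_mem_ofSections]; simp

/-- Section `2` of `ofSections`. [this work] -/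
@[simp] theorem sec_ofSections_two (s₀ s₁ s₂ : Finset (Pt κ)) : sec (ofSections s₀ s₁ s₂) 2 = s₂ := by
  ext x'; rw [mem_sec, glue_mem_ofSections]; simp

/-- Every point of `[3]^{Option κ}` is glued; membership in `ofSections` by cases on the level. [this work] -/
theorem mem_ofSections_iff (s₀ s₁ s₂ : Finset (Pt κ)) (x : Pt (Option κ)) :
    x ∈ ofSections s₀ s₁ s₂ ↔ (fun k => x (some k)) ∈ sec (ofSections s₀ s₁ s₂) (x none) := by
  rw [mem_sec, glue_eta]

/-- The sections of `ofSections` as a function of the level. [this work] -/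
theorem sec_ofSections (s₀ s₁ s₂ : Finset (Pt κ)) (l : Fin 3) : sec (ofSections s₀ s₁ s₂) l = ![s₀, s₁, s₂] l := by
  fin_cases l
  · exact sec_ofSections_zero s₀ s₁ s₂
  · exact sec_ofSections_one s₀ s₁ s₂
  · exact sec_ofSections_two s₀ s₁ s₂

omit [Fintype κ] [DecidableEq κ] in
/-- A nested triple of sets is monotone in the level. [this work] -/
theorem vec3_mono {s₀ s₁ s₂ : Finset (Pt κ)} (h01 : s₀ ⊆ s₁) (h12 : s₁ ⊆ s₂) {l l' : Fin 3} (h : l ≤ l') :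
    (![s₀, s₁, s₂] l : Finset (Pt κ)) ⊆ ![s₀, s₁, s₂] l' := by
  fin_cases l <;> fin_cases l' <;> simp_all [Fin.le_def]
  exact h01.trans h12

/-- `ofSections` of a nested chain of up-sets is an up-set. [this work] -/
theorem isUpperSet_ofSections {s₀ s₁ s₂ : Finset (Pt κ)} (h₀ : IsUpperSet (s₀ : Set (Pt κ))) (h₁ : IsUpperSet (s₁ : Set (Pt κ)))
    (h₂ : IsUpperSet (s₂ : Set (Pt κ))) (h01 : s₀ ⊆ s₁) (h12 : s₁ ⊆ s₂) :
    IsUpperSet ((ofSections s₀ s₁ s₂ : Finset (Pt (Option κ))) : Set (Pt (Option κ))) := by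
  intro x y hxy hx
  rw [Finset.mem_coe, mem_ofSections_iff, sec_ofSections] at hx ⊢
  have hl : x none ≤ y none := hxy none
  have hr : (fun k => x (some k)) ≤ fun k => y (some k) := fun k => hxy (some k)
  have hx' : (fun k => x (some k)) ∈ (![s₀, s₁, s₂] (y none) : Finset (Pt κ)) := vec3_mono h01 h12 hl hx
  have hup : ∀ l : Fin 3, IsUpperSet ((![s₀, s₁, s₂] l : Finset (Pt κ)) : Set (Pt κ)) := by
    intro l; fin_cases l
    · exact h₀
    · exact h₁
    · exact h₂
  exact hup (y none) hr hx'

/-! ## §2  The five-set identity -/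

/-- **FIVE-SET IDENTITY** (every `κ`, arbitrary finsets): the Latin kernel of the triple (cylinder over `A`, lower step `(B,B,B')`, lower step
`(C,C,C')`) of `[3]^{Option κ}` in terms of dimension-`κ` functionals:
`κ = 2κ(A,B,C) + 2κ(A,B,C') + 2κ(A,B',C) + 4[S1(ABC)+S1(AB'C')−S1(ABC')−S1(AB'C)] − 2[L(A,BC)+L(A,B'C')−L(A,BC')−L(A,B'C)]`.
The top-section kernel `κ(A,B',C')` does not occur. [this work] -/
theorem kappa_cyl_lowerStep_lowerStep (A B B' C C' : Finset (Pt κ)) :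
    kappa (ofSections A A A) (ofSections B B B') (ofSections C C C') =
      2 * kappa A B C + 2 * kappa A B C' + 2 * kappa A B' C
        + 4 * (S1 (A ∩ B ∩ C) + S1 (A ∩ B' ∩ C') - S1 (A ∩ B ∩ C') - S1 (A ∩ B' ∩ C))
        - 2 * (latinPairs A (B ∩ C) + latinPairs A (B' ∩ C') - latinPairs A (B ∩ C') - latinPairs A (B' ∩ C)) := by
  rw [kappa_option,
    sum_perm3 (fun i j k =>
      2 * S1 (sec (ofSections A A A) i ∩ sec (ofSections B B B') i ∩ sec (ofSections C C C') i)
        - latinPairs (sec (ofSections A A A) i) (sec (ofSections B B B') j ∩ sec (ofSections C C C') j)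
        - latinPairs (sec (ofSections B B B') i) (sec (ofSections A A A) j ∩ sec (ofSections C C C') j)
        - latinPairs (sec (ofSections C C C') i) (sec (ofSections A A A) j ∩ sec (ofSections B B B') j)
        + latinTriples (sec (ofSections A A A) i) (sec (ofSections B B B') j) (sec (ofSections C C C') k))]
  simp only [sec_ofSections_zero, sec_ofSections_one, sec_ofSections_two]
  rw [kappa_eq_functionals A B C, kappa_eq_functionals A B C', kappa_eq_functionals A B' C]
  rw [latinPairs_comm (B ∩ C) A, latinPairs_comm (B ∩ C') A, latinPairs_comm (B' ∩ C) A,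
    latinPairs_comm (A ∩ C) B, latinPairs_comm (A ∩ C') B, latinPairs_comm (A ∩ C) B',
    latinPairs_comm (A ∩ B) C, latinPairs_comm (A ∩ B) C', latinPairs_comm (A ∩ B') C]
  ring

/-- **Nested form** (the lower-step slots of up-sets): for `B ⊆ B'`, `C ⊆ C'` the bracket terms of the five-set identity are the
functionals of `A` against the increment rectangle `ΔB ∩ ΔC = (B' ∖ B) ∩ (C' ∖ C)`:
`S1(ABC)+S1(AB'C')−S1(ABC')−S1(AB'C) = S1(A ∩ ΔB ∩ ΔC)` and `L(A,BC)+L(A,B'C')−L(A,BC')−L(A,B'C) = L(A, ΔB ∩ ΔC)`. [this work] -/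
theorem kappa_cyl_lowerStep_lowerStep_of_subset {A B B' C C' : Finset (Pt κ)} (hB : B ⊆ B') (hC : C ⊆ C') :
    kappa (ofSections A A A) (ofSections B B B') (ofSections C C C') =
      2 * kappa A B C + 2 * kappa A B C' + 2 * kappa A B' C
        + 4 * S1 (A ∩ (B' \ B) ∩ (C' \ C)) - 2 * latinPairs A ((B' \ B) ∩ (C' \ C)) := by
  rw [kappa_cyl_lowerStep_lowerStep]
  have hind : ∀ y : Pt κ, ind ((B' \ B) ∩ (C' \ C)) y = ind (B' ∩ C') y - ind (B ∩ C') y - ind (B' ∩ C) y + ind (B ∩ C) y := by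
    intro y
    simp only [ind_apply, mem_inter, mem_sdiff]
    by_cases h1 : y ∈ B <;> by_cases h2 : y ∈ B' <;> by_cases h3 : y ∈ C <;> by_cases h4 : y ∈ C' <;>
      simp [h1, h2, h3, h4] <;> first | exact absurd (hB h1) h2 | exact absurd (hC h3) h4
  have hindA : ∀ y : Pt κ, ind (A ∩ (B' \ B) ∩ (C' \ C)) y =
      ind (A ∩ B' ∩ C') y - ind (A ∩ B ∩ C') y - ind (A ∩ B' ∩ C) y + ind (A ∩ B ∩ C) y := by
    intro y
    simp only [ind_apply, mem_inter, mem_sdiff]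
    by_cases h0 : y ∈ A <;> by_cases h1 : y ∈ B <;> by_cases h2 : y ∈ B' <;> by_cases h3 : y ∈ C <;> by_cases h4 : y ∈ C' <;>
      simp [h0, h1, h2, h3, h4] <;> first | exact absurd (hB h1) h2 | exact absurd (hC h3) h4
  have hS : S1 (A ∩ (B' \ B) ∩ (C' \ C)) = S1 (A ∩ B' ∩ C') - S1 (A ∩ B ∩ C') - S1 (A ∩ B' ∩ C) + S1 (A ∩ B ∩ C) := by
    unfold S1
    simp only [hindA, sum_add_distrib, sum_sub_distrib]
  have hL : latinPairs A ((B' \ B) ∩ (C' \ C)) =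
      latinPairs A (B' ∩ C') - latinPairs A (B ∩ C') - latinPairs A (B' ∩ C) + latinPairs A (B ∩ C) := by
    unfold latinPairs
    simp only [hind, mul_add, mul_sub, sum_add_distrib, sum_sub_distrib]
  rw [hS, hL]
  ring

end Summit.CriticalPhenomena.PercolationContinuityZ3.Theorems.SahiLatin
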